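import Summits.AtomisticToContinuum.FouriersLaw.Theses.OddSectorIrreversibility
import Summits.AtomisticToContinuum.FouriersLaw.Theses.FourierGreenKubo
import Literature.MathematicalPhysics.KineticTheory.LangevinChainGibbs
import HarnessLib

/-!
# `GibbsSteadyState` (item stmt-AtomisticToContinuum-0718): the Gibbs state is an equilibrium
# steady state of the pinned anharmonic chain, with zero total current

Route `OddSectorIrreversibility` (support, rank 9; the same statement is
`FourierGreenKubo.FourierGibbsSteadyState`), sub-problem `FouriersLaw`.

**Statement.** For `pinnedChain ω₂ lam β γ` (all parameters `> 0`), every `N` and every `T > 0`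
there is `Z > 0` such that the normalised Gibbs weight
`(ofReal Z)⁻¹ • (e^{-H_N/T} · Lebesgue)` is a weak steady state with equal bath temperatures
`T_L = T_R = T` (`OscillatorChain.IsSteadyState`: probability measure, `∫ L f dμ = 0` for
`f ∈ C_c^∞`, bond currents integrable) and its space-summed steady current `totalCurrent` vanishes.

**Proof.** Take `Z := ∫ e^{-H_N/T} dq dp`, which is finite and positive
(`pinnedChain_integrable_gibbsDensity`, `integral_exp_pos`). By
`OscillatorChain.gibbsMeasure_eq_smul_withDensity` and
`OscillatorChain.partitionFunction_eq_ofReal_integral` the statement's measure IS the tree's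
`(pinnedChain …).gibbsMeasure N T` (Lebesgue measure tilted by `-H/T`), for which weak stationarity at
equal temperatures (Liouville + Ornstein–Uhlenbeck integration by parts) is
`pinnedChain_isSteadyState_gibbsMeasure` and the vanishing of every mean bond current (oddness under
momentum reversal) is `pinnedChain_totalCurrent_gibbsMeasure`
[Bonetto–Lebowitz–Rey-Bellet 2000, §4.1 (10)–(11); Cuneo–Eckmann–Hairer–Rey-Bellet 2018, §3.1].
All ingredients are proved in `Literature/MathematicalPhysics/KineticTheory/LangevinChainGibbs.lean`;
this file is the 10-line identification (candidate first checked by refuter g41-10, G14.lean).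
-/

namespace Summit.AtomisticToContinuum.FouriersLaw.Theorems

open MeasureTheory Literature.MathematicalPhysics.KineticTheory.HeatConduction

/-- For the pinned chain with `ω₂ > 0`, `lam, β ≥ 0`, any `γ`, every `N` and `T > 0`: with
`Z := ∫ e^{-H_N/T}`, one has `Z > 0`, the measure `(ofReal Z)⁻¹ • (e^{-H_N/T} · Lebesgue)` equals the
Gibbs measure `gibbsMeasure N T`, is a weak steady state at `T_L = T_R = T`, and carries zero total
current. (Slightly more general than the item: `lam, β ≥ 0` and `γ` arbitrary.)
[Bonetto–Lebowitz–Rey-Bellet 2000, §4.1; folklore] -/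
theorem gibbs_isSteadyState_and_totalCurrent_eq_zero {ω₂ lam β : ℝ} (hω : 0 < ω₂) (hl : 0 ≤ lam)
    (hβ : 0 ≤ β) (γ : ℝ) (N : ℕ) {T : ℝ} (hT : 0 < T) :
    ∃ Z : ℝ, 0 < Z ∧
      (pinnedChain ω₂ lam β γ).IsSteadyState N T T ((ENNReal.ofReal Z)⁻¹ •
        volume.withDensity (fun x => ENNReal.ofReal
          (Real.exp (-(pinnedChain ω₂ lam β γ).hamiltonian N x / T)))) ∧
      (pinnedChain ω₂ lam β γ).totalCurrent ((ENNReal.ofReal Z)⁻¹ •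
        volume.withDensity (fun x => ENNReal.ofReal
          (Real.exp (-(pinnedChain ω₂ lam β γ).hamiltonian N x / T)))) = 0 := by
  have hint : Integrable ((pinnedChain ω₂ lam β γ).gibbsDensity N T) :=
    pinnedChain_integrable_gibbsDensity hω hl hβ γ N hT
  have hpos : 0 < ∫ x, (pinnedChain ω₂ lam β γ).gibbsDensity N T x := integral_exp_pos hint
  have hμ : (ENNReal.ofReal (∫ x, (pinnedChain ω₂ lam β γ).gibbsDensity N T x))⁻¹ •
      volume.withDensity (fun x => ENNReal.ofReal
        (Real.exp (-(pinnedChain ω₂ lam β γ).hamiltonian N x / T))) =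
      (pinnedChain ω₂ lam β γ).gibbsMeasure N T := by
    rw [(pinnedChain ω₂ lam β γ).gibbsMeasure_eq_smul_withDensity hint,
      (pinnedChain ω₂ lam β γ).partitionFunction_eq_ofReal_integral hint]
    rfl
  refine ⟨∫ x, (pinnedChain ω₂ lam β γ).gibbsDensity N T x, hpos, ?_, ?_⟩
  · rw [hμ]
    exact pinnedChain_isSteadyState_gibbsMeasure hω hl hβ γ N hT
  · rw [hμ]
    exact pinnedChain_totalCurrent_gibbsMeasure ω₂ lam β γ N T

/-- **Settles item stmt-AtomisticToContinuum-0718** (`OddSectorIrreversibility.GibbsSteadyState`,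
support): for all parameters `> 0`, every `N` and `T > 0`, the normalised Gibbs weight
`Z⁻¹ e^{-H_N/T} dq dp` is a weak steady state of the pinned anharmonic chain at equal bath
temperatures `T_L = T_R = T`, with zero total current.
[Bonetto–Lebowitz–Rey-Bellet 2000, §4.1 (10)–(11); folklore] -/
theorem GibbsSteadyState_proof :
    Summit.AtomisticToContinuum.FouriersLaw.Theses.OddSectorIrreversibility.GibbsSteadyState := by
  unfold Summit.AtomisticToContinuum.FouriersLaw.Theses.OddSectorIrreversibility.GibbsSteadyState
  intro ω₂ lam β γ hω hl hβ _hγ N T hT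
  exact gibbs_isSteadyState_and_totalCurrent_eq_zero hω hl.le hβ.le γ N hT

/-- The same statement as filed on route `FourierGreenKubo` (`FourierGibbsSteadyState`, item
stmt-AtomisticToContinuum-0718 shared): the Gibbs weight is an equilibrium weak steady state with
zero total current. [Bonetto–Lebowitz–Rey-Bellet 2000, §4.1 (10)–(11); folklore] -/
theorem FourierGibbsSteadyState_proof :
    Summit.AtomisticToContinuum.FouriersLaw.Theses.FourierGreenKubo.FourierGibbsSteadyState := by
  unfold Summit.AtomisticToContinuum.FouriersLaw.Theses.FourierGreenKubo.FourierGibbsSteadyState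
  intro ω₂ lam β γ hω hl hβ _hγ N T hT
  exact gibbs_isSteadyState_and_totalCurrent_eq_zero hω hl.le hβ.le γ N hT

end Summit.AtomisticToContinuum.FouriersLaw.Theorems
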